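import Literature.Algebra.Lie.LefschetzModuleAdjoint
import Mathlib.LinearAlgebra.Eigenspace.Triangularizable
import HarnessLib

/-!
# Ideals of the Lie algebra of a Lefschetz triple / module are graded (Looijenga–Lunts 1997, (1.2), first clause)

Topic `Literature/Algebra/Lie` (namespace `Literature.Algebra.Lie`).  Lane `lit-hodgefound` (Track 2 foundations
library), skeleton seat `lit-hodgefound-skel-1` (generation 41), row **A1-112** of
`run/shared/lean/pub/lit-hodgefound/SKELETON.md`: the first clause of Looijenga–Lunts (1.2) Lemma ("this
decomposition is graded") with its printed one-line proof, for Lefschetz triples (A1-84) and Lefschetz modules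
(A1-88 / A1-101).  PROVED theorems only (no definition, no named fact, no `sorry`; D-0026 net debt `0`).
`LieRing.ofAssociativeRing` is enabled FILE-LOCALLY as in the rest of the series.

## Source, VERBATIM

E. Looijenga, V. A. Lunts, *A Lie algebra attached to a projective variety*, Invent. Math. **129** (1997) 361–412,
§1 (1.2) (held text `paper:arxiv-alg-geom_9604014` p0004 L94–L105):

> "(1.2) Lemma. Let `M` be an irreducible Lefschetz `𝔞`-module and let `𝔤(𝔞, M) = 𝔤' × 𝔤''` be a decomposition
> of Lie algebra's. Then this decomposition is graded and there exist irreducible Lefschetz `𝔞`-modules `M'` and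
> `M''` such that `M ≅ M' ⊗ M''` as Lefschetz `𝔞`-modules with `𝔤'` resp. `𝔤''` corresponding to `𝔤(𝔞, M')` resp.
> `𝔤(𝔞, M'')`.  Proof. Since the grading of `𝔤` is the eigen space decomposition of `ad_h` it is immediate that
> upon writing `h = (h', h'') ∈ 𝔤' × 𝔤''`, `𝔤^{(i)}` gets a grading from `ad_{h^{(i)}}` making the decomposition a
> graded one."

## Rendering

"a decomposition of Lie algebra's `𝔤 = 𝔤' × 𝔤''`" = complementary ideals `I, J : LieIdeal K L`, `IsCompl I J`;
"graded" = `I = ⊕_k (I ∩ 𝔤_{2k})` as `K`-subspaces (`⨆` of the intersections with the `ad h`-eigenspaces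
`adDegree K h (2k)` of A1-84), and the grading of `𝔤' = I` by its own `ad h'` has the same pieces.

## Contents (all proved)

* `exists_eq_add_of_isCompl_lieIdeal` (`h = h' + h''`, `h' ∈ I`, `h'' ∈ J`, `[h, h'] = [h, h''] = 0`),
  `lie_eq_lie_of_isCompl_lieIdeal` (`[h, x] = [h', x]` on `I`), `mem_adDegree_iff_of_isCompl_lieIdeal`;
* **`lieIdeal_eq_iSup_inf_adDegree_of_iSup_eq_top`** (any `𝔤 = Σ_i 𝔤_{d i}`: every ideal is the sum of its
  intersections with the eigenspaces of `ad h` — Mathlib `Submodule.eq_iSup_inf_genEigenspace`);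
  **`IsLefschetzTriple.lieIdeal_eq_iSup_inf_adDegree`**, `IsLefschetzTriple.lieIdeal_eq_iSup_inf_adDegree_of_isCompl`
  (the grading of `𝔤'` "from `ad_{h'}`"), **`IsLefschetzModule.lieIdeal_eq_iSup_inf_adDegree`** ((1.2) first clause
  as printed, for `𝔤(𝔞, M)` via A1-101 §2).

## SCOPE (what is NOT formalised here)

(a) The remainder of (1.2) — `M ≅ M' ⊗ M''` for an irreducible `M` (needs `K` algebraically closed: irreducible
representations of `𝔤' × 𝔤''` are external tensor products) — is not formalised.  (b) Nothing here concerns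
complex tori or the Hodge conjecture.

## References

* [LooijengaLunts1997] E. Looijenga, V. A. Lunts, *A Lie algebra attached to a projective variety*, Invent. Math. 129
  (1997) 361–412; arXiv:alg-geom/9604014. §1 (1.2), p. 4 L94–L105 of the held text.
-/

namespace Literature.Algebra.Lie

open Module Function Set LieModule LieAlgebra

-- The commutator Lie ring of `𝔤𝔩(M) = Module.End K M`: Mathlib's reducible NON-instance, enabled file-locally
-- exactly as in `LefschetzModule.lean`.
attribute [local instance 100] LieRing.ofAssociativeRing

section IdealGrading

variable {K : Type*} [Field K] {L : Type*} [LieRing L] [LieAlgebra K L] {h : L} {I J : LieIdeal K L}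

/-- **"upon writing `h = (h', h'')  ∈ 𝔤' × 𝔤''`"**: for complementary ideals `I ⊕ J = 𝔤`, `h = h' + h''` with
`h' ∈ I`, `h'' ∈ J`, and both commute with `h` (`[h, h'] = -[h, h''] ∈ I ∩ J = 0`).
[cite: LooijengaLunts1997, §1 (1.2) p. 4 L101–L105] -/
theorem exists_eq_add_of_isCompl_lieIdeal (hIJ : IsCompl I J) (h : L) :
    ∃ h' ∈ I, ∃ h'' ∈ J, h = h' + h'' ∧ ⁅h, h'⁆ = 0 ∧ ⁅h, h''⁆ = 0 := by
  have hmem : h ∈ I ⊔ J := by rw [hIJ.sup_eq_top]; exact LieSubmodule.mem_top h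
  obtain ⟨h', hh', h'', hh'', rfl⟩ := (LieSubmodule.mem_sup _ _ _).1 hmem
  have h1 : ⁅h' + h'', h'⁆ ∈ I := I.lie_mem hh'
  have h2 : ⁅h' + h'', h''⁆ ∈ J := J.lie_mem hh''
  have h3 : ⁅h' + h'', h'⁆ + ⁅h' + h'', h''⁆ = 0 := by rw [← lie_add, lie_self]
  have h4 : ⁅h' + h'', h'⁆ ∈ I ⊓ J := by
    refine (LieSubmodule.mem_inf _ _ _).2 ⟨h1, ?_⟩
    rw [eq_neg_of_add_eq_zero_left h3]
    exact neg_mem h2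
  rw [hIJ.inf_eq_bot, LieSubmodule.mem_bot] at h4
  rw [h4, zero_add] at h3
  exact ⟨h', hh', h'', hh'', rfl, h4, h3⟩

/-- On `𝔤' = I` the grading element acts through its `I`-component: `[h, x] = [h', x]` for `x ∈ I`
(`[h'', x] ∈ I ∩ J = 0`). [cite: LooijengaLunts1997, §1 (1.2) p. 4 L101–L105] -/
theorem lie_eq_lie_of_isCompl_lieIdeal (hIJ : IsCompl I J) {h' h'' : L} (hh'' : h'' ∈ J)
    (hsum : h = h' + h'') {x : L} (hx : x ∈ I) : ⁅h, x⁆ = ⁅h', x⁆ := by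
  have h1 : ⁅h'', x⁆ ∈ I ⊓ J := by
    refine (LieSubmodule.mem_inf _ _ _).2 ⟨I.lie_mem hx, ?_⟩
    rw [← lie_skew]
    exact neg_mem (J.lie_mem hh'')
  rw [hIJ.inf_eq_bot, LieSubmodule.mem_bot] at h1
  rw [hsum, add_lie, h1, add_zero]

/-- Hence the degrees of `𝔤' = I` for `ad h` and for `ad h'` coincide: `I ∩ 𝔤_c(h) = I ∩ 𝔤_c(h')`.
[cite: LooijengaLunts1997, §1 (1.2) p. 4 L101–L105] -/
theorem mem_adDegree_iff_of_isCompl_lieIdeal (hIJ : IsCompl I J) {h' h'' : L} (hh'' : h'' ∈ J)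
    (hsum : h = h' + h'') {x : L} (hx : x ∈ I) {c : K} : x ∈ adDegree K h c ↔ x ∈ adDegree K h' c := by
  rw [mem_adDegree_iff, mem_adDegree_iff, lie_eq_lie_of_isCompl_lieIdeal hIJ hh'' hsum hx]

variable [FiniteDimensional K L]

/-- **"Since the grading of `𝔤` is the eigen space decomposition of `ad_h` … the decomposition [is] a graded one"**:
when `ad h` is diagonalisable (`𝔤 = Σ_i 𝔤_{d i}`, e.g. a Lefschetz triple), every ideal `I` of `𝔤` is graded:
`I = ⊕_i (I ∩ 𝔤_{d i})` — an `ad h`-stable subspace of a diagonalisable operator is the sum of its intersections with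
the eigenspaces (Mathlib `Submodule.eq_iSup_inf_genEigenspace`). [cite: LooijengaLunts1997, §1 (1.2) p. 4 L101–L105] -/
theorem lieIdeal_eq_iSup_inf_adDegree_of_iSup_eq_top {ι : Type*} {d : ι → K} (hgr : ⨆ i, adDegree K h (d i) = ⊤)
    (I : LieIdeal K L) : (I : Submodule K L) = ⨆ i, (I : Submodule K L) ⊓ adDegree K h (d i) := by
  have hinv : ∀ x ∈ (I : Submodule K L), (ad K L h) x ∈ (I : Submodule K L) := fun x hx ↦ I.lie_mem hx
  have htop : ⨆ μ : K, (ad K L h).genEigenspace μ 1 = ⊤ := by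
    rw [eq_top_iff, ← hgr]
    exact iSup_le fun i ↦ le_iSup (fun μ : K ↦ (ad K L h).genEigenspace μ 1) (d i)
  have h1 := Submodule.eq_iSup_inf_genEigenspace 1 hinv htop
  refine le_antisymm (h1.le.trans ?_) (iSup_le fun i ↦ inf_le_left)
  refine iSup_le fun μ ↦ ?_
  by_cases hμ : ∃ i, d i = μ
  · obtain ⟨i, rfl⟩ := hμ
    exact le_iSup (fun i ↦ (I : Submodule K L) ⊓ adDegree K h (d i)) i
  · have h2 : adDegree K h μ = ⊥ := adDegree_eq_bot_of_iSup_eq_top h hgr fun i hi ↦ hμ ⟨i, hi⟩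
    have h3 : (I : Submodule K L) ⊓ (ad K L h).genEigenspace μ 1 = ⊥ := by
      rw [eq_bot_iff, ← h2]
      exact inf_le_right
    rw [h3]
    exact bot_le

/-- **(1.2), first clause, for a Lefschetz triple**: every ideal of `𝔤` is graded, `I = ⊕_k (I ∩ 𝔤_{2k})`.
[cite: LooijengaLunts1997, §1 (1.2) p. 4 L94–L105] -/
theorem IsLefschetzTriple.lieIdeal_eq_iSup_inf_adDegree [CharZero K] {𝔞 : Submodule K L}
    (T : IsLefschetzTriple K h 𝔞) (I : LieIdeal K L) :
    (I : Submodule K L) = ⨆ k : ℤ, (I : Submodule K L) ⊓ adDegree K h (2 * (k : K)) :=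
  lieIdeal_eq_iSup_inf_adDegree_of_iSup_eq_top T.iSup_adDegree_even_eq_top I

/-- … and for complementary ideals `𝔤 = 𝔤' ⊕ 𝔤''` of a Lefschetz triple, `𝔤'` is graded by its own `ad h'`
with the same pieces: `𝔤' = ⊕_k (𝔤' ∩ 𝔤_{2k}(h'))` ("`𝔤^{(i)}` gets a grading from `ad_{h^{(i)}}` making the
decomposition a graded one"). [cite: LooijengaLunts1997, §1 (1.2) p. 4 L94–L105] -/
theorem IsLefschetzTriple.lieIdeal_eq_iSup_inf_adDegree_of_isCompl [CharZero K] {𝔞 : Submodule K L}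
    (T : IsLefschetzTriple K h 𝔞) (hIJ : IsCompl I J) {h' h'' : L} (hh'' : h'' ∈ J) (hsum : h = h' + h'') :
    (I : Submodule K L) = ⨆ k : ℤ, (I : Submodule K L) ⊓ adDegree K h' (2 * (k : K)) := by
  have h1 := T.lieIdeal_eq_iSup_inf_adDegree I
  have h2 : ∀ c : K, (I : Submodule K L) ⊓ adDegree K h c = (I : Submodule K L) ⊓ adDegree K h' c := fun c ↦ by
    ext x
    simp only [Submodule.mem_inf]
    exact ⟨fun hx ↦ ⟨hx.1, (mem_adDegree_iff_of_isCompl_lieIdeal hIJ hh'' hsum hx.1).1 hx.2⟩,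
      fun hx ↦ ⟨hx.1, (mem_adDegree_iff_of_isCompl_lieIdeal hIJ hh'' hsum hx.1).2 hx.2⟩⟩
  simp only [← h2]
  exact h1

end IdealGrading

/-! ## For Lefschetz modules: ideals of `𝔤(𝔞, M)` are graded -/

section ModuleIdeals

variable {K : Type*} [Field K] [CharZero K] {M : Type*} [AddCommGroup M] [Module K M] [FiniteDimensional K M]
  {h : Module.End K M} {𝔞 : Submodule K (Module.End K M)}

/-- **(1.2), first clause, as printed**: for a Lefschetz module `(𝔞, M)` and "a decomposition of Lie algebra's
`𝔤(𝔞, M) = 𝔤' × 𝔤''`" — indeed for any ideal `𝔤'` of `𝔤(𝔞, M)` — "this decomposition is graded":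
`𝔤' = ⊕_k (𝔤' ∩ 𝔤(𝔞, M)_{2k})`. [cite: LooijengaLunts1997, §1 (1.2) p. 4 L94–L105] -/
theorem IsLefschetzModule.lieIdeal_eq_iSup_inf_adDegree (A : IsLefschetzModule K h 𝔞)
    (I : LieIdeal K (lefschetzLieAlgebra K h 𝔞)) :
    (I : Submodule K (lefschetzLieAlgebra K h 𝔞)) =
      ⨆ k : ℤ, (I : Submodule K (lefschetzLieAlgebra K h 𝔞)) ⊓
        adDegree K (⟨h, A.h_mem⟩ : lefschetzLieAlgebra K h 𝔞) (2 * (k : K)) := by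
  haveI : FiniteDimensional K (lefschetzLieAlgebra K h 𝔞) :=
    inferInstanceAs (FiniteDimensional K (lefschetzLieAlgebra K h 𝔞).toSubmodule)
  exact A.isLefschetzTriple.lieIdeal_eq_iSup_inf_adDegree I

end ModuleIdeals

end Literature.Algebra.Lie
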